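import Mathlib
import Literature.Analysis.Convex.SchauderFixedPoint
import HarnessLib

/-!
# The Tychonoff (Schauder–Tychonoff) fixed point theorem

Tychonoff (1935) extended Brouwer's and Schauder's fixed point theorems to locally convex spaces:
*a continuous self-map of a nonempty compact convex subset `K` of a Hausdorff locally convex
topological vector space has a fixed point* [cite: ReedSimonI1980, Thm V.19]
[cite: Rudin1991, Thm 5.28].  The tree's `SchauderFixedPoint` file proves the statement for real
normed spaces; this file removes the norm.

* `exists_apply_sub_mem` — **approximate fixed points** in any real topological vector space:
  for every convex open neighbourhood `U` of `0` there is `x ∈ K` with `f x - x ∈ U`.  Proof by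
  the Schauder mapping built from Minkowski gauges (as in S. Cobzaş, *Fixed point theorems in
  locally convex spaces — the Schauder mapping method*, Fixed Point Theory Appl. 2006,
  Lemma 2.1 / Thm 2.3): cover `K` by finitely many translates `zᵢ + U` (`zᵢ ∈ K`), put
  `wᵢ(y) = max (0, 1 - gauge U (y - zᵢ))` (continuous, `wᵢ(y) > 0 ↔ y - zᵢ ∈ U`), and apply
  Brouwer's theorem (the tree's `exists_fixedPoint_of_mapsTo_isCompact` on the standard simplex)
  to `w ↦ (wᵢ(f (∑ⱼ wⱼ zⱼ)) / ∑ₖ wₖ(f (∑ⱼ wⱼ zⱼ)))ᵢ`; at a fixed point, `x = ∑ cᵢ zᵢ` with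
  `cᵢ > 0` only when `f x - zᵢ ∈ U`, so `f x - x = ∑ cᵢ (f x - zᵢ) ∈ U` by convexity of `U`.
* `exists_fixedPoint` — **Tychonoff's theorem** in a Hausdorff locally convex space: the sets
  `{x ∈ K | f x - x ∈ closure U}` are closed with the finite intersection property, and
  `⋂_U closure U = {0}` over the convex open neighbourhoods `U` of `0` (regularity + local
  convexity + Hausdorff).
* `exists_fixedPoint_of_continuous` — the same for an everywhere continuous `f` with `f '' K ⊆ K`.

Deviations: `f : E → E` with continuity and invariance asked only on `K`; the approximate
statement needs neither local convexity nor the Hausdorff property.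
-/

open Set Filter Topology

noncomputable section

namespace Literature.Analysis.Convex.TychonoffFixedPoint

variable {E : Type*} [AddCommGroup E] [Module ℝ E] [TopologicalSpace E] [IsTopologicalAddGroup E]
  [ContinuousSMul ℝ E]

/-! ### Schauder weights from the Minkowski gauge -/

/-- The Schauder weight of the point `z` for the neighbourhood `U`:
`weight U z y = max 0 (1 - gauge U (y - z))`. [folklore] -/
def weight (U : Set E) (z y : E) : ℝ := max 0 (1 - gauge U (y - z))

omit [TopologicalSpace E] [IsTopologicalAddGroup E] [ContinuousSMul ℝ E] in
/-- Schauder weights are nonnegative. [folklore] -/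
private theorem weight_nonneg {U : Set E} {z y : E} : 0 ≤ weight U z y := le_max_left _ _

/-- Schauder weights are continuous (the gauge of a convex neighbourhood of `0` is continuous).
[folklore] -/
private theorem continuous_weight {U : Set E} (hUc : Convex ℝ U) (hU : U ∈ 𝓝 (0 : E)) (z : E) :
    Continuous (weight U z) :=
  continuous_const.max
    (continuous_const.sub ((continuous_gauge hUc hU).comp (continuous_id.sub continuous_const)))

/-- For a convex open `U ∋ 0`, the weight of `z` at `y` is positive iff `y - z ∈ U`. [folklore] -/
private theorem weight_pos_iff {U : Set E} (hUc : Convex ℝ U) (hU0 : (0 : E) ∈ U) (hUo : IsOpen U)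
    {z y : E} : 0 < weight U z y ↔ y - z ∈ U := by
  unfold weight
  rw [lt_max_iff, sub_pos]
  simp only [lt_irrefl, false_or]
  constructor
  · intro h
    have h' : y - z ∈ {x | gauge U x < 1} := h
    rwa [setOf_gauge_lt_one_eq_interior hUc (hUo.mem_nhds hU0), hUo.interior_eq] at h'
  · intro h
    exact gauge_lt_one_of_mem_of_isOpen hUo h

/-! ### The Schauder mapping of a finite net -/

/-- Total Schauder weight of the finite family `t`. [folklore] -/
def totalWeight (U : Set E) (t : Finset E) (y : E) : ℝ := ∑ z ∈ t, weight U z y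

/-- Barycentre map of the standard simplex on `t`: `w ↦ ∑ᵢ wᵢ zᵢ`. [folklore] -/
def bary (t : Finset E) (w : ↥t → ℝ) : E := ∑ i : ↥t, w i • (i : E)

/-- The Schauder self-map of the standard simplex on `t` attached to `f` and `U`:
`w ↦ (wᵢ(f (bary w)) / ∑ⱼ wⱼ(f (bary w)))ᵢ`. [folklore] -/
def schauderMap (U : Set E) (t : Finset E) (f : E → E) (w : ↥t → ℝ) : ↥t → ℝ :=
  fun i => weight U (i : E) (f (bary t w)) / totalWeight U t (f (bary t w))

/-- The total weight is positive at every point covered by the translates `z + U`, `z ∈ t`.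
[folklore] -/
private theorem totalWeight_pos {U : Set E} (hUc : Convex ℝ U) (hU0 : (0 : E) ∈ U) (hUo : IsOpen U)
    {t : Finset E} {y : E} (hy : ∃ z ∈ t, y - z ∈ U) : 0 < totalWeight U t y := by
  obtain ⟨z, hz, hyz⟩ := hy
  have h1 : 0 < weight U z y := (weight_pos_iff hUc hU0 hUo).mpr hyz
  exact lt_of_lt_of_le h1
    (Finset.single_le_sum (f := fun z => weight U z y) (fun i _ => weight_nonneg) hz)

/-- The total weight is continuous. [folklore] -/
private theorem continuous_totalWeight {U : Set E} (hUc : Convex ℝ U) (hU : U ∈ 𝓝 (0 : E))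
    (t : Finset E) : Continuous (totalWeight U t) := by
  unfold totalWeight
  exact continuous_finsetSum _ fun z _ => continuous_weight hUc hU z

/-- The barycentre map is continuous. [folklore] -/
private theorem continuous_bary (t : Finset E) : Continuous (bary t) := by
  unfold bary
  exact continuous_finsetSum _ fun i _ => (continuous_apply i).smul continuous_const

omit [TopologicalSpace E] [IsTopologicalAddGroup E] [ContinuousSMul ℝ E] in
/-- Barycentres of simplex points with nodes in a convex set stay in the set. [folklore] -/
private theorem bary_mem {K : Set E} (hKconv : Convex ℝ K) {t : Finset E} (htK : ∀ z ∈ t, z ∈ K)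
    {w : ↥t → ℝ} (hw : w ∈ stdSimplex ℝ ↥t) : bary t w ∈ K :=
  hKconv.sum_mem (fun i _ => hw.1 i) hw.2 (fun i _ => htK i i.2)

/-! ### Approximate fixed points (any real topological vector space) -/

/-- **Approximate fixed points via the Schauder mapping**: if `K` is a nonempty compact convex
subset of a real topological vector space, `f` is continuous on `K` with `f(K) ⊆ K`, and `U` is
a convex open neighbourhood of `0`, then `f x - x ∈ U` for some `x ∈ K`.
[cite: Rudin1991, Thm 5.28 (proof)] -/
theorem exists_apply_sub_mem {K : Set E} (hKc : IsCompact K) (hKconv : Convex ℝ K)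
    (hKne : K.Nonempty) {f : E → E} (hf : ContinuousOn f K) (hmaps : MapsTo f K K)
    {U : Set E} (hU0 : (0 : E) ∈ U) (hUo : IsOpen U) (hUc : Convex ℝ U) :
    ∃ x ∈ K, f x - x ∈ U := by
  classical
  have hUn : U ∈ 𝓝 (0 : E) := hUo.mem_nhds hU0
  -- a finite cover of `K` by the sets `{y | y - z ∈ U}`, `z ∈ K`
  obtain ⟨t, htK, hcov⟩ := hKc.elim_nhds_subcover (fun z => {y | y - z ∈ U}) fun z _ =>
    (hUo.preimage (continuous_id.sub continuous_const)).mem_nhds (by simp [hU0])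
  have hcov' : ∀ y ∈ K, ∃ z ∈ t, y - z ∈ U := fun y hy => by
    obtain ⟨z, hz, hyz⟩ := mem_iUnion₂.mp (hcov hy)
    exact ⟨z, hz, hyz⟩
  obtain ⟨x₀, hx₀⟩ := hKne
  obtain ⟨z₀, hz₀, -⟩ := hcov' x₀ hx₀
  have hSpos : ∀ y ∈ K, 0 < totalWeight U t y := fun y hy => totalWeight_pos hUc hU0 hUo (hcov' y hy)
  -- the Schauder self-map of the simplex is continuous and maps the simplex into itself
  have hfh : ContinuousOn (fun w => f (bary t w)) (stdSimplex ℝ ↥t) :=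
    hf.comp (continuous_bary t).continuousOn fun w hw => bary_mem hKconv htK hw
  have hGcont : ContinuousOn (schauderMap U t f) (stdSimplex ℝ ↥t) := by
    refine continuousOn_pi.mpr fun i => ?_
    exact ((continuous_weight hUc hUn (i : E)).comp_continuousOn hfh).div
      ((continuous_totalWeight hUc hUn t).comp_continuousOn hfh)
      fun w hw => (hSpos _ (hmaps (bary_mem hKconv htK hw))).ne'
  have hGmaps : MapsTo (schauderMap U t f) (stdSimplex ℝ ↥t) (stdSimplex ℝ ↥t) := by
    intro w hw
    have hS := hSpos _ (hmaps (bary_mem hKconv htK hw))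
    refine ⟨fun i => div_nonneg weight_nonneg hS.le, ?_⟩
    show ∑ i : ↥t, weight U (i : E) (f (bary t w)) / totalWeight U t (f (bary t w)) = 1
    rw [← Finset.sum_div, Finset.sum_coe_sort t (fun z => weight U z (f (bary t w))),
      ← totalWeight, div_self hS.ne']
  -- Brouwer on the standard simplex (tree)
  obtain ⟨w, hw, hGw⟩ := Literature.Analysis.Convex.exists_fixedPoint_of_mapsTo_isCompact
    (convex_stdSimplex ℝ ↥t) (isClosed_stdSimplex ℝ ↥t)
    ⟨_, single_mem_stdSimplex ℝ (⟨z₀, hz₀⟩ : ↥t)⟩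
    (isCompact_stdSimplex ℝ ↥t) hGcont hGmaps hGmaps
  -- unpack the fixed point: `x = ∑ cᵢ zᵢ` with `cᵢ > 0` only if `f x - zᵢ ∈ U`
  have hxK : bary t w ∈ K := bary_mem hKconv htK hw
  have hS := hSpos _ (hmaps hxK)
  refine ⟨bary t w, hxK, ?_⟩
  have hc0 : ∀ i, 0 ≤ schauderMap U t f w i := fun i => div_nonneg weight_nonneg hS.le
  have hc1 : ∑ i, schauderMap U t f w i = 1 := (hGmaps hw).2
  have hxc : bary t w = ∑ i : ↥t, schauderMap U t f w i • (i : E) := by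
    conv_lhs => rw [← hGw]
    rfl
  have key : f (bary t w) - bary t w =
      ∑ i : ↥t, schauderMap U t f w i • (f (bary t w) - (i : E)) := by
    simp only [smul_sub, Finset.sum_sub_distrib, ← Finset.sum_smul, hc1, one_smul]
    rw [← hxc]
  rw [key, ← Finset.sum_filter_of_ne (p := fun i => 0 < schauderMap U t f w i)
    (fun i _ hne => lt_of_le_of_ne (hc0 i) fun h0 => hne (by rw [← h0, zero_smul]))]
  refine hUc.sum_mem (fun i _ => hc0 i) ?_ (fun i hi => ?_)
  · rw [Finset.sum_filter_of_ne (fun i _ hne => lt_of_le_of_ne (hc0 i) (Ne.symm hne)), hc1]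
  · have hci : 0 < schauderMap U t f w i := (Finset.mem_filter.mp hi).2
    have hwpos : 0 < weight U (i : E) (f (bary t w)) := (div_pos_iff_of_pos_right hS).mp hci
    exact (weight_pos_iff hUc hU0 hUo).mp hwpos

/-! ### Tychonoff's fixed point theorem (Hausdorff locally convex spaces) -/

variable [LocallyConvexSpace ℝ E] [T2Space E]

/-- **Tychonoff's fixed point theorem** (Schauder–Tychonoff; Tychonoff 1935): a map which is
continuous on a nonempty compact convex subset `K` of a Hausdorff locally convex real topological
vector space and maps `K` into itself has a fixed point in `K`.
[cite: ReedSimonI1980, Thm V.19] [cite: Rudin1991, Thm 5.28] -/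
theorem exists_fixedPoint {K : Set E} (hKc : IsCompact K) (hKconv : Convex ℝ K)
    (hKne : K.Nonempty) {f : E → E} (hf : ContinuousOn f K) (hmaps : MapsTo f K K) :
    ∃ x ∈ K, f x = x := by
  classical
  let J := {U : Set E // (0 : E) ∈ U ∧ IsOpen U ∧ Convex ℝ U}
  let A : J → Set E := fun U => K ∩ (fun y => f y - y) ⁻¹' closure (U : Set E)
  have hAcl : ∀ U, IsClosed (A U) := fun U =>
    (hf.sub continuousOn_id).preimage_isClosed_of_isClosed hKc.isClosed isClosed_closure
  -- finite intersection property from approximate fixed points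
  have hfip : ∀ u : Finset J, (K ∩ ⋂ U ∈ u, A U).Nonempty := by
    intro u
    have hV0 : (0 : E) ∈ ⋂ U ∈ u, (U : Set E) := mem_iInter₂.mpr fun U _ => U.2.1
    have hVo : IsOpen (⋂ U ∈ u, (U : Set E)) := isOpen_biInter_finset fun U _ => U.2.2.1
    have hVc : Convex ℝ (⋂ U ∈ u, (U : Set E)) := convex_iInter₂ fun U _ => U.2.2.2
    obtain ⟨x, hxK, hx⟩ := exists_apply_sub_mem hKc hKconv hKne hf hmaps hV0 hVo hVc
    refine ⟨x, hxK, mem_iInter₂.mpr fun U hU => ⟨hxK, ?_⟩⟩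
    exact subset_closure ((mem_iInter₂.mp hx) U hU)
  obtain ⟨x, hxK, hx⟩ := hKc.inter_iInter_nonempty A hAcl hfip
  refine ⟨x, hxK, ?_⟩
  -- `f x - x` lies in the closure of every convex open neighbourhood of `0`, hence is `0`
  by_contra hne
  have hv : (0 : E) ≠ f x - x := fun h0 => hne (sub_eq_zero.mp h0.symm)
  have h1 : {f x - x}ᶜ ∈ 𝓝 (0 : E) := isOpen_compl_singleton.mem_nhds hv
  obtain ⟨C, ⟨hCn, hCcl⟩, hCsub⟩ := (closed_nhds_basis (0 : E)).mem_iff.mp h1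
  obtain ⟨U, ⟨hU0, hUo, hUc⟩, hUC⟩ := (LocallyConvexSpace.convex_open_basis_zero ℝ E).mem_iff.mp hCn
  have hxU : f x - x ∈ closure U := ((mem_iInter.mp hx) ⟨U, hU0, hUo, hUc⟩).2
  have hxC : f x - x ∈ C := (hCcl.closure_subset_iff.mpr hUC) hxU
  exact (mem_compl_singleton_iff.mp (hCsub hxC)) rfl

/-- **Tychonoff's fixed point theorem** for an everywhere continuous map leaving a nonempty compact
convex set invariant. [cite: ReedSimonI1980, Thm V.19] -/
theorem exists_fixedPoint_of_continuous {K : Set E} (hKc : IsCompact K) (hKconv : Convex ℝ K)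
    (hKne : K.Nonempty) {f : E → E} (hf : Continuous f) (hmaps : MapsTo f K K) :
    ∃ x ∈ K, f x = x :=
  exists_fixedPoint hKc hKconv hKne hf.continuousOn hmaps

#harness_tags exists_apply_sub_mem
#harness_tags exists_fixedPoint

end Literature.Analysis.Convex.TychonoffFixedPoint
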